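import Literature.Probability.LatticeModels.IsingThermodynamics
import Mathlib.MeasureTheory.Function.ConditionalExpectation.Real
import Mathlib.MeasureTheory.Constructions.Cylinders
import Mathlib.Analysis.InnerProductSpace.PiL2
import Mathlib.MeasureTheory.Measure.Haar.InnerProductSpace
import HarnessLib

/-!
# Crux `GaussianLimitNotScreened` (stmt-CriticalPhenomena-13886, route PerfectScreening r4): vocabulary of
# the line `single-layer-linear-regression`

Route-posited objects (D-0016 `<Route>Defs`-type file) shared by the registered stubs of the checked
skeleton `Cruxes/GaussianLimitNotScreened/Lines/single_layer_linear_regression.lean` (line lead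
prover-line-stmt-CriticalPhenomena-13886-c1-0, 2026-08-16) and by the crux file that composes them. Nothing is
asserted here: every declaration is a finite-volume object or a concrete functional over tree definitions
(`criticalTwoPoint`, `isingMeasure`, `zdGraph`, `box`, `criticalBeta`, `spinAt`) and Mathlib
(`cylinderEvents`, `condExp`, `EuclideanSpace`).

* `deepSite n = (n,0,0)`, `layerSite u = (0,u)` — the deep site and the sites of the layer `{x₀ = 0}`;
* `layerRegressionForm n s c = G(2n e₀) − 2Σ_{u∈s} c_u G(n,u) + Σ_{u,v∈s} c_uc_v G(0,u−v)`, `G = ⟨σ₀σ_·⟩⁺_{β_c(3)}`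
  — the two-point REGRESSION FORM (by reflection positivity `⟨FθF⟩ ≥ 0`, `F = σ_{(n,0,0)} − Σc_uσ_{(0,u)}`; by
  the nearest-neighbour Markov property the thermodynamic limit of the mean-square regression residual below);
* `boxMeasure L` — the critical plus measure `μ⁺_{[-L,L]³; β_c(3), 0}`; `layerEvents` — the σ-algebra of the
  layer spins; `regression n L = E_L[σ_{(n,0,0)} | layer]` (Mathlib `condExp`); `linStat s c = Σ_{u∈s}c_uσ_{(0,u)}`;
  `msResidual n s c L = E_L[(regression − linStat)²]`;
* `planeVec`, `profileCoeff φ n u = n⁻²φ(u/n)`, `layerBox R n = {u ∈ ℤ² | |uᵢ| ≤ Rn}` — discretised continuum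
  profiles on the layer;
* `contQ Δ φ = 2∫φ(v)(1+|v|²)^{−Δ}dv − ∫∫φ(v)φ(w)|v−w|^{−2Δ}dv dw` — the continuum quadratic functional of the
  line (the generalised-free-field kernel read on the plane at heights `1` and `0`);
* `stub_regressionVocabulary` — the registered bookkeeping stub through which this file lands `--supports`.

References: J. Glimm, A. Jaffe, *Quantum Physics* (2nd ed., 1987), §6.1 pp. 89–90 (transfer matrix / reflection)
[GlimmJaffe1987]; S. Friedli, Y. Velenik, *Statistical Mechanics of Lattice Systems* (2017), §3.1
[FriedliVelenik2017]; N. S. Landkof, *Foundations of Modern Potential Theory* (1972), Ch. IV §5 [Landkof1972].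
-/

noncomputable section

namespace Summit.CriticalPhenomena.Ising3DConformalLimit.Cruxes.GaussianLimitNotScreened.SingleLayerLinearRegression

open MeasureTheory Filter Topology
open Literature.Probability.LatticeModels

/-! ## §A. Lattice objects of the layer geometry -/

/-- The transverse plane `ℝ²` of the layer `{x₀ = 0}`. [folklore] -/
abbrev E2 : Type := EuclideanSpace ℝ (Fin 2)

/-- The deep site `(n, 0, 0) ∈ ℤ³` at depth `n` above the layer. [folklore] -/
def deepSite (n : ℕ) : Site 3 := Fin.cons (n : ℤ) 0

/-- The layer site `(0, u) ∈ ℤ³`, `u ∈ ℤ²`. [folklore] -/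
def layerSite (u : Fin 2 → ℤ) : Site 3 := Fin.cons 0 u

/-- **The two-point REGRESSION FORM** `G(2n e₀) − 2 Σ_{u∈s} c_u G(n,u) + Σ_{u,v∈s} c_u c_v G(0,u−v)`,
`G = ⟨σ₀σ_·⟩⁺_{β_c(3)}` (`criticalTwoPoint 3`): by site-reflection positivity through the plane `{x₀ = 0}`
it is `⟨F θF⟩ ≥ 0` with `F = σ_{(n,0,0)} − Σ c_u σ_{(0,u)}`, and by the Markov property it is the thermodynamic
limit of the mean-square NONLINEAR-regression residual `‖E[σ_{(n,0,0)}|layer] − Σ c_u σ_{(0,u)}‖²`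
(registered stub `stub_markovRegression`). [cite: GlimmJaffe1987, §6.1 Remark 'Transfer matrix of statistical physics', pp. 89–90] -/
def layerRegressionForm (n : ℕ) (s : Finset (Fin 2 → ℤ)) (c : (Fin 2 → ℤ) → ℝ) : ℝ :=
  criticalTwoPoint 3 (Pi.single 0 ((2 * n : ℕ) : ℤ))
    - 2 * ∑ u ∈ s, c u * criticalTwoPoint 3 (Fin.cons (n : ℤ) u)
    + ∑ u ∈ s, ∑ v ∈ s, c u * c v * criticalTwoPoint 3 (Fin.cons 0 (u - v))

/-! ## §B. The finite-volume regression (critical plus measure on `[-L,L]³`) -/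

/-- The critical finite-volume plus measure `μ_L = μ⁺_{[-L,L]³; β_c(3), 0}` of the nearest-neighbour
Ising model (tree `isingMeasure`, a probability measure on `SpinConfig (Site 3)`). [cite: FriedliVelenik2017, §3.1 Def. 3.1] -/
def boxMeasure (L : ℕ) : Measure (SpinConfig (Site 3)) :=
  isingMeasure (zdGraph 3) (box 3 L) (criticalBeta 3) 0 BoundaryCondition.plus

/-- The σ-algebra generated by the spins ON THE LAYER `{y ∈ ℤ³ | y₀ = 0}` (Mathlib `cylinderEvents`;
it is `≤` the product σ-algebra, so `condExp` below is the genuine conditional expectation). [folklore] -/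
abbrev layerEvents : MeasurableSpace (SpinConfig (Site 3)) :=
  cylinderEvents {y : Site 3 | y 0 = 0}

/-- **The deep-spin regression** `m_L⁽ⁿ⁾ := E_L[σ_{(n,0,0)} | layer]` (Mathlib `condExp` w.r.t.
`layerEvents` under `boxMeasure L`). [folklore] -/
def regression (n L : ℕ) : SpinConfig (Site 3) → ℝ :=
  (boxMeasure L)[spinAt (deepSite n) | layerEvents]

/-- A linear statistic `Σ_{u∈s} c_u σ_{(0,u)}` of the layer spins. [folklore] -/
def linStat (s : Finset (Fin 2 → ℤ)) (c : (Fin 2 → ℤ) → ℝ) (σ : SpinConfig (Site 3)) : ℝ :=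
  ∑ u ∈ s, c u * spinAt (layerSite u) σ

/-- **The mean-square regression residual** `E_L[(m_L⁽ⁿ⁾ − Σ c_u σ_{(0,u)})²]` in the box of radius `L`.
[folklore] -/
def msResidual (n : ℕ) (s : Finset (Fin 2 → ℤ)) (c : (Fin 2 → ℤ) → ℝ) (L : ℕ) : ℝ :=
  ∫ σ, (regression n L σ - linStat s c σ) ^ 2 ∂(boxMeasure L)

/-! ## §C. Discretised continuum profiles and the continuum functional -/

/-- The point of `ℝ²` under a lattice vector `u ∈ ℤ²`. [folklore] -/
def planeVec (u : Fin 2 → ℤ) : E2 := WithLp.toLp 2 fun i => (u i : ℝ)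

/-- **Discretised continuum profile**: `c_u = n⁻² φ(u/n)`. [folklore] -/
def profileCoeff (φ : E2 → ℝ) (n : ℕ) (u : Fin 2 → ℤ) : ℝ :=
  φ ((n : ℝ)⁻¹ • planeVec u) / (n : ℝ) ^ 2

/-- The transverse box `{u ∈ ℤ² | |uᵢ| ≤ R·n}`, a finite superset of the support of `u ↦ φ(u/n)` when `φ`
vanishes outside the ball of radius `R`. [folklore] -/
def layerBox (R n : ℕ) : Finset (Fin 2 → ℤ) :=
  Fintype.piFinset fun _ : Fin 2 => Finset.Icc (-((R * n : ℕ) : ℤ)) ((R * n : ℕ) : ℤ)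

/-- **The continuum quadratic functional** `Q_Δ(φ) = 2∫ φ(v)(1+|v|²)^{−Δ} dv − ∫∫ φ(v)φ(w)|v−w|^{−2Δ} dv dw`:
`2⟨φ, p₁⟩ − ⟨φ, p₀φ⟩` for the generalised-free-field kernel `p_t(v) = (t² + |v|²)^{−Δ}` read on the plane at
heights `t = 1` and `t = 0` (Lebesgue measure of `ℝ²`; the diagonal `v = w` is null, `2Δ < 2`). The first
integral is parenthesised ON PURPOSE: the integral binder extends to the right over `-`. [cite: Landkof1972, Chapter IV §5] -/
def contQ (Δ : ℝ) (φ : E2 → ℝ) : ℝ :=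
  2 * (∫ v : E2, φ v * (1 + ‖v‖ ^ 2) ^ (-Δ))
    - ∫ v : E2, ∫ w : E2, φ v * φ w * ‖v - w‖ ^ (-(2 * Δ))

/-! ## §D. Bookkeeping (the registered vocabulary stub through which this file lands `--supports`) -/

/-- **Registered bookkeeping stub `stub_regressionVocabulary`**: with no layer sites the regression form is the
bare axis two-point function `G(2n e₀)` (the trivial predictor `0`; the residual ratio of the line starts at `1`).
[folklore] -/
theorem stub_regressionVocabulary :
    ∀ (n : ℕ) (c : (Fin 2 → ℤ) → ℝ),
      layerRegressionForm n ∅ c = criticalTwoPoint 3 (Pi.single 0 ((2 * n : ℕ) : ℤ)) := by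
  intro n c
  simp [layerRegressionForm]

end Summit.CriticalPhenomena.Ising3DConformalLimit.Cruxes.GaussianLimitNotScreened.SingleLayerLinearRegression

end
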